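import Literature.Computability.Complexity.AverageCaseDepthHierarchyProcess
import Literature.Computability.Complexity.CircuitLowerBoundsHastadProofs
import HarnessLib

/-!
# Approximators collapse under the random projections (RST §9.6) — the deterministic part

B. Rossman, R. A. Servedio, L.-Y. Tan, *An average-case depth hierarchy theorem for Boolean
circuits*, arXiv:1504.03398 [RossmanServedioTan2015], §9.6 (pp. 29–30: Theorem 9, Lemma 8 and
Proposition 8 — each random projection reduces the depth of the approximating circuit by one,
applying the projection switching lemma to every bottom depth-2 subcircuit and a union bound),
Remark 1 (p. 14: the projection of a decision tree is a decision tree of the same depth), and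
§11.1 Proposition 14 (p. 37, after O'Donnell–Wimmer: a shallow decision tree cannot agree with a
restricted wide `∨`/`∧` much more than a constant does).

This file contains the deterministic, circuit-side bookkeeping of RST's "approximator simplifies"
argument, for the tree's straight-line circuits over `acBasis` (unbounded fan-in `∧`, `∨`, free
`¬`), in the style of `CircuitLowerBoundsHastadProofs.lean` (whose wire functions `GateList.wireFn`,
heights `GateList.wireHt` and gate equations are reused) but relative to a COMPOSITE INPUT MAP
`E : (X → Bool) → (ι → Bool)` from the current variables to the circuit's inputs — a projection
replaces `E` by `E ∘ expand ρ`, changing the variable type from `A × P` to `A`: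

* `DTree.project` (Remark 1), `DTree.pathDNF` (the DNF of accepting paths of a tree: repetition-
  free terms of width `≤` depth);
* `GoodWireE gs E d w` (the wire `w` computes, through `E`, a function with a decision tree of depth
  `≤ d` over the current variables), `InvE` (all valid wires of height `≤ h` are good),
  `gateDNFE` (the width-`d` DNF attached to an `∧`/`∨` gate whose children are good);
* `invE_zero` (before any projection, height `0`, depth `1`), `invE_project` (**the step**: if the
  wires of height `≤ h` are good over `A × P` and, for every `∧`/`∨` gate of height `h+1`, the
  canonical projection decision tree of its attached DNF under `ρ` has depth `≤ s`, then all wires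
  of height `≤ h+1` are good with bound `s` over `A` through `E ∘ expand ρ`) — RST Lemma 8 /
  Prop. 8 without the probability;
* `disagree_ge_bias` — **Proposition 14 for decision trees**: under a product law, a decision tree
  of depth `≤ r` disagrees with the `∨` (resp. `∧`) of the free variables of a block with
  probability at least `bias - r t`, `t` the probability of the controlling value.

No probability beyond finite sums; the union bounds and the process are assembled in the sibling
file proving Theorem 1.
-/

noncomputable section

namespace Literature.Computability.Complexity

namespace RSTProj

open Finset GateList

/-! ### Decision trees: projection and the DNF of accepting paths -/

namespace DTree

variable {A P X : Type*}

/-- **The projection of a decision tree** (RST Remark 1): queries of fixed variables are resolved,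
queries of `x_{a,i}` become queries of `y_a`. [cite: RossmanServedioTan2015, Remark 1 (p. 14)] -/
def project (ρ : BRestr A P) : DTree (A × P) → DTree A
  | leaf b => leaf b
  | node v t₀ t₁ =>
    match ρ v.1 v.2 with
    | some false => t₀.project ρ
    | some true => t₁.project ρ
    | none => node v.1 (t₀.project ρ) (t₁.project ρ)

/-- The projected tree computes the projection. [cite: RossmanServedioTan2015, Remark 1 (p. 14)] -/
theorem eval_project (ρ : BRestr A P) (y : A → Bool) : ∀ T : DTree (A × P), (T.project ρ).eval y = T.eval (ρ.expand y)
  | leaf b => rfl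
  | node v t₀ t₁ => by
    simp only [project]
    rcases hρ : ρ v.1 v.2 with _ | ⟨_ | _⟩
    · simp [eval, BRestr.expand, hρ, eval_project ρ y t₀, eval_project ρ y t₁]
    · simp [eval, BRestr.expand, hρ, eval_project ρ y t₀]
    · simp [eval, BRestr.expand, hρ, eval_project ρ y t₁]

/-- Projection does not increase the depth. [cite: RossmanServedioTan2015, Remark 1 (p. 14)] -/
theorem depth_project_le (ρ : BRestr A P) : ∀ T : DTree (A × P), (T.project ρ).depth ≤ T.depth
  | leaf b => le_rfl
  | node v t₀ t₁ => by
    unfold project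
    have h₀ := depth_project_le ρ t₀
    have h₁ := depth_project_le ρ t₁
    rcases ρ v.1 v.2 with _ | _ | _ <;> simp only [depth_node] <;> omega

variable [DecidableEq X]

/-- The accepting paths of a decision tree as the terms of a DNF: `acc` is the list of literals
already fixed on the current path (a repeated query follows the consistent branch). [folklore] -/
def pathDNF : DTree X → Clause X → CNF X
  | leaf b, acc => if b then [acc] else []
  | node v t₀ t₁, acc =>
    match acc.find? (fun l => l.1 = v) with
    | some l => if l.2 then t₁.pathDNF acc else t₀.pathDNF acc
    | none => t₀.pathDNF ((v, false) :: acc) ++ t₁.pathDNF ((v, true) :: acc)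

/-- Terms of the path DNF have length at most the depth plus the length of the prefix. [folklore] -/
theorem length_le_of_mem_pathDNF : ∀ (T : DTree X) (acc : Clause X),
    ∀ C ∈ T.pathDNF acc, C.length ≤ T.depth + acc.length
  | leaf b, acc, C, hC => by
    unfold pathDNF at hC
    split_ifs at hC
    · simp only [List.mem_singleton] at hC; subst hC; simp
    · simp at hC
  | node v t₀ t₁, acc, C, hC => by
    unfold pathDNF at hC
    simp only [depth_node]
    split at hC
    · split_ifs at hC
      · have := length_le_of_mem_pathDNF t₁ acc C hC; omega
      · have := length_le_of_mem_pathDNF t₀ acc C hC; omega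
    · rcases List.mem_append.1 hC with h | h
      · have := length_le_of_mem_pathDNF t₀ _ C h
        simp only [List.length_cons] at this; omega
      · have := length_le_of_mem_pathDNF t₁ _ C h
        simp only [List.length_cons] at this; omega

/-- Terms of the path DNF have pairwise distinct variables (if the prefix has). [folklore] -/
theorem varNodup_of_mem_pathDNF [DecidableEq A] [DecidableEq P] : ∀ (T : DTree (A × P)) (acc : Clause (A × P)),
    VarNodup acc → ∀ C ∈ T.pathDNF acc, VarNodup C
  | leaf b, acc, hacc, C, hC => by
    unfold pathDNF at hC
    split_ifs at hC
    · simp only [List.mem_singleton] at hC; subst hC; exact hacc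
    · simp at hC
  | node v t₀ t₁, acc, hacc, C, hC => by
    unfold pathDNF at hC
    split at hC
    · split_ifs at hC
      · exact varNodup_of_mem_pathDNF t₁ acc hacc C hC
      · exact varNodup_of_mem_pathDNF t₀ acc hacc C hC
    · rename_i hnone
      have hv : v ∉ acc.map Prod.fst := by
        intro hv
        obtain ⟨l, hl, rfl⟩ := List.mem_map.1 hv
        have := List.find?_eq_none.1 hnone l hl
        simp at this
      have hcons : ∀ b : Bool, VarNodup ((v, b) :: acc) := fun b => by
        unfold VarNodup at hacc ⊢
        rw [List.map_cons]
        exact List.nodup_cons.2 ⟨hv, hacc⟩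
      rcases List.mem_append.1 hC with h | h
      · exact varNodup_of_mem_pathDNF t₀ _ (hcons false) C h
      · exact varNodup_of_mem_pathDNF t₁ _ (hcons true) C h

/-- Semantics of the path DNF: an input satisfies some term iff it agrees with the prefix and is
accepted by the tree. [folklore] -/
theorem any_pathDNF (x : X → Bool) : ∀ (T : DTree X) (acc : Clause X),
    ((T.pathDNF acc).any fun C => C.all (Literal.eval x)) = (acc.all (Literal.eval x) && T.eval x)
  | leaf b, acc => by
    unfold pathDNF
    cases b <;> simp
  | node v t₀ t₁, acc => by
    unfold pathDNF
    split
    · rename_i l hl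
      have hlacc : l ∈ acc := List.mem_of_find?_eq_some hl
      have hlv : l.1 = v := by simpa using List.find?_some hl
      by_cases hall : acc.all (Literal.eval x) = true
      · have hx : x v = l.2 := by
          have := List.all_eq_true.1 hall l hlacc
          simpa [Literal.eval, hlv] using this
        split_ifs with hb
        · rw [any_pathDNF x t₁ acc, eval_node, hx, hb]; rfl
        · rw [any_pathDNF x t₀ acc, eval_node, hx]
          simp [hb]
      · have hall' : acc.all (Literal.eval x) = false := eq_false_of_ne_true hall
        split_ifs
        · rw [any_pathDNF x t₁ acc, hall']; rfl
        · rw [any_pathDNF x t₀ acc, hall']; rfl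
    · rw [List.any_append, any_pathDNF x t₀, any_pathDNF x t₁, eval_node]
      simp only [List.all_cons, Literal.eval]
      cases x v <;> cases acc.all (Literal.eval x) <;> simp

/-- The path DNF of `T` (empty prefix) is a DNF for the function computed by `T`. [folklore] -/
theorem evalDNF_pathDNF (T : DTree X) (x : X → Bool) : (T.pathDNF []).evalDNF x = T.eval x := by
  have := any_pathDNF x T []
  simpa [CNF.evalDNF] using this

/-- Terms of `T.pathDNF []` have width at most the depth of `T`. [folklore] -/
theorem length_le_depth_of_mem_pathDNF (T : DTree X) {C : Clause X} (hC : C ∈ T.pathDNF []) :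
    C.length ≤ T.depth := by
  simpa using length_le_of_mem_pathDNF T [] C hC

/-- Terms of `T.pathDNF []` have pairwise distinct variables. [folklore] -/
theorem varNodup_of_mem_pathDNF_nil [DecidableEq A] [DecidableEq P] (T : DTree (A × P)) {C : Clause (A × P)}
    (hC : C ∈ T.pathDNF []) : VarNodup C :=
  varNodup_of_mem_pathDNF T [] (by simp [VarNodup]) C hC

end DTree

/-! ### Good wires through a composite input map -/

section Wires

variable {ι X : Type*}

/-- The wire `w` of the program `gs` is *good* through the input map `E` with bound `d`: the
function `x ↦ wireFn gs w (E x)` of the current variables has a decision tree of depth `≤ d`.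
[cite: RossmanServedioTan2015, §9.6 (p. 29, "`proj_ρ C` is a depth-`(ℓ-1)` circuit with bottom fan-in `w^{1/5}`")] -/
def GoodWireE (gs : List (Gate ι)) (E : (X → Bool) → (ι → Bool)) (d : ℕ) (w : ι ⊕ ℕ) : Prop :=
  ∃ T : DTree X, T.depth ≤ d ∧ ∀ x, T.eval x = wireFn gs w (E x)

variable {gs : List (Gate ι)} {E : (X → Bool) → (ι → Bool)}

/-- Goodness is monotone in the depth bound. [folklore] -/
theorem GoodWireE.mono {d d' : ℕ} {w : ι ⊕ ℕ} (h : GoodWireE gs E d w) (hd : d ≤ d') : GoodWireE gs E d' w := by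
  obtain ⟨T, hT, hTe⟩ := h
  exact ⟨T, hT.trans hd, hTe⟩

/-- A wire carrying the negation of a good wire is good (negate the tree). [folklore] -/
theorem GoodWireE.of_not {d : ℕ} {u : ι ⊕ ℕ} {j : ℕ} (hu : GoodWireE gs E d u)
    (hnot : ∀ x, wireFn gs (.inr j) x = !(wireFn gs u x)) : GoodWireE gs E d (.inr j) := by
  obtain ⟨T, hT, hTe⟩ := hu
  refine ⟨T.negate, by simpa using hT, fun x => ?_⟩
  rw [DTree.eval_negate, hTe, hnot]

/-- **Goodness passes through a projection** (project the tree; RST Remark 1). [cite: RossmanServedioTan2015, Remark 1 (p. 14)] -/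
theorem GoodWireE.project {A P : Type*} {gs : List (Gate ι)} {E : (A × P → Bool) → (ι → Bool)} {d : ℕ}
    {w : ι ⊕ ℕ} (h : GoodWireE gs E d w) (ρ : BRestr A P) :
    GoodWireE gs (fun y => E (ρ.expand y)) d w := by
  obtain ⟨T, hT, hTe⟩ := h
  exact ⟨T.project ρ, (DTree.depth_project_le ρ T).trans hT, fun y => by rw [DTree.eval_project, hTe]⟩

open Classical in
/-- A chosen small tree of a wire (a dummy leaf if the wire is not good). [folklore] -/
def treeOfE (gs : List (Gate ι)) (E : (X → Bool) → (ι → Bool)) (d : ℕ) (w : ι ⊕ ℕ) : DTree X :=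
  if h : GoodWireE gs E d w then Classical.choose h else .leaf false

/-- The chosen tree is small. [folklore] -/
theorem depth_treeOfE_le (gs : List (Gate ι)) (E : (X → Bool) → (ι → Bool)) (d : ℕ) (w : ι ⊕ ℕ) :
    (treeOfE gs E d w).depth ≤ d := by
  unfold treeOfE
  split_ifs with h
  · exact (Classical.choose_spec h).1
  · exact Nat.zero_le _

/-- The chosen tree of a good wire computes the wire function through `E`. [folklore] -/
theorem eval_treeOfE {d : ℕ} {w : ι ⊕ ℕ} (h : GoodWireE gs E d w) (x : X → Bool) :
    (treeOfE gs E d w).eval x = wireFn gs w (E x) := by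
  unfold treeOfE
  rw [dif_pos h]
  exact (Classical.choose_spec h).2 x

/-- **The invariant**: every valid wire of height `≤ h` is good with bound `d`. [cite: RossmanServedioTan2015, §9.6 Lemma 8 (p. 29)] -/
def InvE (gs : List (Gate ι)) (E : (X → Bool) → (ι → Bool)) (h d : ℕ) : Prop :=
  ∀ w : ι ⊕ ℕ, OutOK gs.length w → wireHt gs w ≤ h → GoodWireE gs E d w

/-- The invariant passes through a projection at the same height. [cite: RossmanServedioTan2015, Remark 1 (p. 14)] -/
theorem InvE.project {A P : Type*} {gs : List (Gate ι)} {E : (A × P → Bool) → (ι → Bool)} {h d : ℕ}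
    (hinv : InvE gs E h d) (ρ : BRestr A P) : InvE gs (fun y => E (ρ.expand y)) h d :=
  fun w hw hh => (hinv w hw hh).project ρ

/-! ### The DNF attached to a gate -/

variable [DecidableEq X]

/-- The DNF attached to the gate `g` through `E` (children trees of depth `≤ d`): for a disjunction
gate the union of the path DNFs of the children's trees (a DNF for the gate); otherwise the union
of the path DNFs of the negated trees (for a conjunction gate, a DNF for the NEGATION of the gate)
— the bottom depth-2 subcircuit to which the projection switching lemma is applied. [cite: RossmanServedioTan2015, §9.6 Lemma 8 (p. 29)] -/
def gateDNFE (gs : List (Gate ι)) (E : (X → Bool) → (ι → Bool)) (d : ℕ) (g : Gate ι) : CNF X :=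
  if g.fn = GateFn.or g.arity then
    (List.ofFn fun a : Fin g.arity => (treeOfE gs E d (g.args a)).pathDNF []).flatten
  else
    (List.ofFn fun a : Fin g.arity => (treeOfE gs E d (g.args a)).negate.pathDNF []).flatten

omit [DecidableEq X] in
/-- The attached DNF has repetition-free terms of width `≤ d`. [folklore] -/
theorem gateDNFE_wf {A P : Type*} [DecidableEq A] [DecidableEq P] (E : (A × P → Bool) → (ι → Bool)) (d : ℕ) (g : Gate ι) :
    ∀ Cl ∈ gateDNFE gs E d g, VarNodup Cl ∧ Cl.length ≤ d := by
  intro Cl hCl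
  unfold gateDNFE at hCl
  split_ifs at hCl with hor
  · obtain ⟨l, hl, hCl⟩ := List.mem_flatten.1 hCl
    obtain ⟨a, rfl⟩ := List.mem_ofFn.1 hl
    exact ⟨DTree.varNodup_of_mem_pathDNF_nil _ hCl,
      (DTree.length_le_depth_of_mem_pathDNF _ hCl).trans (depth_treeOfE_le gs E d _)⟩
  · obtain ⟨l, hl, hCl⟩ := List.mem_flatten.1 hCl
    obtain ⟨a, rfl⟩ := List.mem_ofFn.1 hl
    refine ⟨DTree.varNodup_of_mem_pathDNF_nil _ hCl,
      (DTree.length_le_depth_of_mem_pathDNF _ hCl).trans ?_⟩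
    rw [DTree.depth_negate]
    exact depth_treeOfE_le gs E d _

omit [DecidableEq X] in
/-- Semantics of a union of DNFs. [folklore] -/
theorem evalDNF_flatten_ofFn' {k : ℕ} (G : Fin k → CNF X) (y : X → Bool) :
    CNF.evalDNF (List.ofFn G).flatten y = true ↔ ∃ a, (G a).evalDNF y = true := by
  unfold CNF.evalDNF
  rw [List.any_eq_true]
  constructor
  · rintro ⟨Cl, hCl, hall⟩
    obtain ⟨l, hl, hCl'⟩ := List.mem_flatten.1 hCl
    obtain ⟨a, rfl⟩ := List.mem_ofFn.1 hl
    exact ⟨a, List.any_eq_true.2 ⟨Cl, hCl', hall⟩⟩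
  · rintro ⟨a, ha⟩
    obtain ⟨Cl, hCl, hall⟩ := List.any_eq_true.1 ha
    exact ⟨Cl, List.mem_flatten.2 ⟨G a, List.mem_ofFn.2 ⟨a, rfl⟩, hCl⟩, hall⟩

/-- **Disjunction gates**: if all children are good, the attached DNF computes the gate through `E`. [cite: RossmanServedioTan2015, §9.6 Lemma 8 (p. 29)] -/
theorem evalDNF_gateDNFE_or (hwf : WF gs) {d : ℕ} {j : ℕ} (hj : j < gs.length)
    (hor : (gs[j]).fn = GateFn.or (gs[j]).arity) (hgood : ∀ a : Fin (gs[j]).arity, GoodWireE gs E d ((gs[j]).args a))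
    (y : X → Bool) : (gateDNFE gs E d gs[j]).evalDNF y = wireFn gs (.inr j) (E y) := by
  obtain ⟨hval, -, -⟩ := or_gate_spec hwf hj hor
  rw [hval, Bool.eq_iff_iff, decide_eq_true_iff]
  unfold gateDNFE
  rw [if_pos hor, evalDNF_flatten_ofFn']
  refine exists_congr fun a => ?_
  rw [DTree.evalDNF_pathDNF, eval_treeOfE (hgood a)]

/-- **Conjunction gates**: if all children are good, the attached DNF computes the NEGATION of the
gate through `E`. [cite: RossmanServedioTan2015, §9.6 Lemma 8 (p. 29)] -/
theorem evalDNF_gateDNFE_and (hwf : WF gs) {d : ℕ} {j : ℕ} (hj : j < gs.length) {k : ℕ}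
    (hand : (gs[j]).fn = GateFn.and k) (hnor : ¬ (gs[j]).fn = GateFn.or (gs[j]).arity)
    (hgood : ∀ a : Fin (gs[j]).arity, GoodWireE gs E d ((gs[j]).args a)) (y : X → Bool) :
    (gateDNFE gs E d gs[j]).evalDNF y = !(wireFn gs (.inr j) (E y)) := by
  obtain ⟨hval, -, -⟩ := and_gate_spec hwf hj hand
  rw [hval, Bool.eq_iff_iff]
  unfold gateDNFE
  rw [if_neg hnor, evalDNF_flatten_ofFn']
  simp only [Bool.not_eq_true', decide_eq_false_iff_not, not_forall]
  refine exists_congr fun a => ?_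
  rw [DTree.evalDNF_pathDNF, DTree.eval_negate, eval_treeOfE (hgood a)]
  simp

omit [DecidableEq X] in
/-- A gate of `acBasis` that is neither a negation nor a disjunction is a conjunction
(`HastadParity.exists_fn_eq_and`, generalised from input wires `Fin n` to an arbitrary index type `ι`,
as needed for circuits over `Addr _`). [folklore] -/
theorem exists_fn_eq_and' (hB : ∀ g ∈ gs, g.fn ∈ acBasis) {j : ℕ} (hj : j < gs.length)
    (hnot : (gs[j]).fn ≠ GateFn.not) (hnor : ¬ (gs[j]).fn = GateFn.or (gs[j]).arity) :
    ∃ k, (gs[j]).fn = GateFn.and k := by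
  rcases acBasis_trichotomy hB hj with h | ⟨k, h | h⟩
  · exact absurd h hnot
  · exact ⟨k, h⟩
  · exfalso; apply hnor
    have hk : k = (gs[j]).arity := (congrArg Sigma.fst h).symm
    rw [h, hk]

omit [DecidableEq X] in
/-- The children of an `∧`/`∨` gate of height `≤ h + 1` have height `≤ h`, and the gate has
height `≥ 1` (`HastadParity.children_ht`, generalised from `Fin n` to an arbitrary `ι`). [folklore] -/
theorem children_ht' (hwf : WF gs) (hB : ∀ g ∈ gs, g.fn ∈ acBasis) {j : ℕ} (hj : j < gs.length)
    (hnot : (gs[j]).fn ≠ GateFn.not) :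
    (∀ a : Fin (gs[j]).arity, wireHt gs ((gs[j]).args a) + 1 ≤ wireHt gs (.inr j)) ∧ 1 ≤ wireHt gs (.inr j) := by
  rcases acBasis_trichotomy hB hj with h | ⟨k, h | h⟩
  · exact absurd h hnot
  · exact (and_gate_spec hwf hj h).2
  · exact (or_gate_spec hwf hj h).2

omit [DecidableEq X] in
/-- The argument wires of a gate are valid wires of the program (`HastadParity.outOK_args` for an
arbitrary input index type `ι`). [folklore] -/
theorem outOK_args' (hwf : WF gs) {j : ℕ} (hj : j < gs.length) (a : Fin (gs[j]).arity) :
    OutOK gs.length ((gs[j]).args a) := fun _ hm => (args_lt hwf hj a hm).trans hj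

/-! ### The invariant: base and step -/

omit [DecidableEq X] in
/-- **Base**: through a renaming of the inputs `E x = x ∘ e`, the wires of height `0` (inputs and
chains of negations over an input) have decision trees of depth `1`. [cite: RossmanServedioTan2015, §9.6 Prop. 8 (p. 29, the start of the induction)] -/
theorem invE_zero (hwf : WF gs) (hB : ∀ g ∈ gs, g.fn ∈ acBasis) (e : ι → X) :
    InvE gs (fun x i => x (e i)) 0 1 := by
  have hinl : ∀ i : ι, GoodWireE gs (fun (x : X → Bool) i => x (e i)) 1 (.inl i) := fun i =>
    ⟨.node (e i) (.leaf false) (.leaf true), le_rfl, fun x => by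
      rw [wireFn_inl]; simp only [DTree.eval_node, DTree.eval_leaf]; cases x (e i) <;> rfl⟩
  suffices hg : ∀ j, j < gs.length → wireHt gs (.inr j) ≤ 0 → GoodWireE gs (fun (x : X → Bool) i => x (e i)) 1 (.inr j) by
    intro w hw hh
    cases w with
    | inl i => exact hinl i
    | inr m => exact hg m (hw m rfl) hh
  intro j
  induction j using Nat.strong_induction_on with
  | _ j ih =>
    intro hj hht
    by_cases hnot : (gs[j]).fn = GateFn.not
    · obtain ⟨u, hu, hval, hhtu⟩ := not_gate_spec hwf hj hnot
      refine GoodWireE.of_not ?_ hval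
      cases u with
      | inl i => exact hinl i
      | inr m =>
        have hm := hu m rfl
        exact ih m hm (hm.trans hj) (by rw [← hhtu]; exact hht)
    · have := (children_ht' hwf hB hj hnot).2
      omega

/-- **Step through a projection** (RST Lemma 8 / Prop. 8, deterministic part): if every valid
wire of height `≤ h` is good over `A × P` through `E` with bound `d ≥ 1`, and for every `∧`/`∨`
gate of height `h + 1` the canonical projection decision tree, under `ρ`, of its attached width-`d`
DNF has depth `≤ s` (`d ≤ s`), then every valid wire of height `≤ h + 1` is good over `A` through
`E ∘ expand ρ` with bound `s`. [cite: RossmanServedioTan2015, §9.6 Lemma 8 and Prop. 8 (p. 29)] -/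
theorem invE_project {A P : Type*} [DecidableEq A] [DecidableEq P] [Fintype A] [Fintype P]
    {gs : List (Gate ι)} (hwf : WF gs) (hB : ∀ g ∈ gs, g.fn ∈ acBasis)
    {E : (A × P → Bool) → (ι → Bool)} {h d s : ℕ} (hd : 1 ≤ d) (hds : d ≤ s) (hinv : InvE gs E h d)
    (ρ : BRestr A P)
    (hgood : ∀ j (hj : j < gs.length), wireHt gs (.inr j) = h + 1 → (gs[j]).fn ≠ GateFn.not →
      pcdt (gateDNFE gs E d gs[j]) ρ ≤ s) :
    InvE gs (fun y => E (ρ.expand y)) (h + 1) s := by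
  have hs : 1 ≤ s := hd.trans hds
  have hinl : ∀ i : ι, GoodWireE gs (fun y => E (ρ.expand y)) s (.inl i) := fun i =>
    ((hinv (.inl i) (fun _ h => absurd h Sum.inl_ne_inr) (by rw [wireHt_inl]; exact Nat.zero_le _)).project ρ).mono hds
  suffices hg : ∀ j, j < gs.length → wireHt gs (.inr j) ≤ h + 1 → GoodWireE gs (fun y => E (ρ.expand y)) s (.inr j) by
    intro w hw hh
    cases w with
    | inl i => exact hinl i
    | inr m => exact hg m (hw m rfl) hh
  intro j
  induction j using Nat.strong_induction_on with
  | _ j ih =>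
    intro hj hht
    by_cases hnot : (gs[j]).fn = GateFn.not
    · obtain ⟨u, hu, hval, hhtu⟩ := not_gate_spec hwf hj hnot
      refine GoodWireE.of_not ?_ hval
      cases u with
      | inl i => exact hinl i
      | inr m =>
        have hm := hu m rfl
        exact ih m hm (hm.trans hj) (by rw [← hhtu]; exact hht)
    · obtain ⟨hch, h1⟩ := children_ht' hwf hB hj hnot
      by_cases hle : wireHt gs (.inr j) ≤ h
      · exact ((hinv (.inr j) (fun m hm => by cases hm; exact hj) hle).project ρ).mono hds
      · have heq : wireHt gs (.inr j) = h + 1 := by omega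
        have hgoodch : ∀ a : Fin (gs[j]).arity, GoodWireE gs E d ((gs[j]).args a) := fun a =>
          hinv _ (outOK_args' hwf hj a) (by have := hch a; omega)
        have hcdt := hgood j hj heq hnot
        have hwfF := gateDNFE_wf (gs := gs) E d gs[j]
        obtain ⟨T, hT, hTe⟩ := exists_dtree_of_pcdt_le (gateDNFE gs E d gs[j]) hcdt
        by_cases hor : (gs[j]).fn = GateFn.or (gs[j]).arity
        · refine ⟨T, hT, fun y => ?_⟩
          rw [hTe, evalDNF_gateDNFE_or hwf hj hor hgoodch]
        · obtain ⟨k, hand⟩ := exists_fn_eq_and' hB hj hnot hor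
          refine ⟨T.negate, by simpa using hT, fun y => ?_⟩
          rw [DTree.eval_negate, hTe, evalDNF_gateDNFE_and hwf hj hand hor hgoodch, Bool.not_not]

end Wires

/-! ### Proposition 14 for decision trees (after O'Donnell–Wimmer) -/

namespace DTree

variable {X : Type*}

/-- The variables queried along the path followed by `y`. [folklore] -/
def qpath (y : X → Bool) : DTree X → List X
  | leaf _ => []
  | node v t₀ t₁ => v :: (if y v then t₁.qpath y else t₀.qpath y)

/-- A path queries at most `depth` variables. [folklore] -/
theorem length_qpath_le (y : X → Bool) : ∀ T : DTree X, (T.qpath y).length ≤ T.depth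
  | leaf _ => le_rfl
  | node v t₀ t₁ => by
    have h₀ := length_qpath_le y t₀
    have h₁ := length_qpath_le y t₁
    simp only [qpath, List.length_cons, depth_node]
    split <;> omega

/-- Inputs that agree on the path of `y` follow it and get the same output. [folklore] -/
theorem eval_eq_of_agree {y y' : X → Bool} : ∀ T : DTree X, (∀ v ∈ T.qpath y, y' v = y v) → T.eval y' = T.eval y
  | leaf _, _ => rfl
  | node v t₀ t₁, h => by
    have hv : y' v = y v := h v (by simp [qpath])
    simp only [eval_node, hv]
    cases hy : y v
    · simp only [Bool.false_eq_true, if_false]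
      exact eval_eq_of_agree t₀ fun u hu => h u (by simp [qpath, hy, hu])
    · simp only [if_true]
      exact eval_eq_of_agree t₁ fun u hu => h u (by simp [qpath, hy, hu])

end DTree

section Prop14

variable {w : ℕ}

/-- A product law on `Fin w → Bool` from per-coordinate weights. [folklore] -/
def prodLaw (p : Fin w → Bool → ℝ) (za : Fin w → Bool) : ℝ := ∏ i, p i (za i)

/-- **Marginals of a product law.** [folklore] -/
theorem sum_prodLaw_mul_indicator (p : Fin w → Bool → ℝ) (hp : ∀ i, ∑ b : Bool, p i b = 1) (i : Fin w) (b : Bool) :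
    ∑ za : Fin w → Bool, prodLaw p za * (if za i = b then 1 else 0) = p i b := by
  classical
  have key : ∀ za : Fin w → Bool, prodLaw p za * (if za i = b then 1 else 0) =
      ∏ j, (if j = i then (if za j = b then p j (za j) else 0) else p j (za j)) := by
    intro za
    rw [prodLaw, ← Finset.mul_prod_erase univ _ (Finset.mem_univ i), ← Finset.mul_prod_erase univ
      (fun j => if j = i then (if za j = b then p j (za j) else 0) else p j (za j)) (Finset.mem_univ i)]
    simp only [if_true]
    have : ∏ j ∈ univ.erase i, (if j = i then (if za j = b then p j (za j) else 0) else p j (za j)) =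
        ∏ j ∈ univ.erase i, p j (za j) :=
      Finset.prod_congr rfl fun j hj => by rw [if_neg (Finset.ne_of_mem_erase hj)]
    rw [this]
    split_ifs <;> ring
  rw [Finset.sum_congr rfl fun za _ => key za]
  have h := Finset.prod_univ_sum (fun (_ : Fin w) => (univ : Finset Bool))
    (fun j c => if j = i then (if c = b then p j c else 0) else p j c)
  simp only [Fintype.piFinset_univ] at h
  rw [← h, ← Finset.mul_prod_erase univ _ (Finset.mem_univ i)]
  simp only [if_true]
  have : ∏ j ∈ univ.erase i, ∑ c : Bool, (if j = i then (if c = b then p j c else 0) else p j c) = 1 :=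
    Finset.prod_eq_one fun j hj => by simp only [if_neg (Finset.ne_of_mem_erase hj)]; exact hp j
  rw [this, mul_one, Finset.sum_ite_eq' univ b]; simp

/-- **Union bound** over the coordinates of a list, under a product law with marginals `≤ t` for the
value `c`. [folklore] -/
theorem sum_prodLaw_exists_le (p : Fin w → Bool → ℝ) (hp : ∀ i, ∑ b : Bool, p i b = 1)
    (hp0 : ∀ i b, 0 ≤ p i b) (c : Bool) {t : ℝ} (ht : ∀ i, p i c ≤ t) :
    ∀ Q : List (Fin w), ∑ za : Fin w → Bool, prodLaw p za * (if (∃ i ∈ Q, za i = c) then 1 else 0) ≤ Q.length * t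
  | [] => by simp
  | i :: Q => by
    classical
    have hν : ∀ za : Fin w → Bool, 0 ≤ prodLaw p za := fun za => Finset.prod_nonneg fun j _ => hp0 _ _
    have key : ∀ za : Fin w → Bool, prodLaw p za * (if (∃ j ∈ i :: Q, za j = c) then (1 : ℝ) else 0) ≤
        prodLaw p za * (if za i = c then 1 else 0) + prodLaw p za * (if (∃ j ∈ Q, za j = c) then 1 else 0) := by
      intro za
      rw [← mul_add]
      refine mul_le_mul_of_nonneg_left ?_ (hν za)
      have hA : (if (∃ j ∈ i :: Q, za j = c) then (1 : ℝ) else 0) ≤ 1 := by split_ifs <;> norm_num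
      have hB : (0 : ℝ) ≤ (if za i = c then 1 else 0) := by split_ifs <;> norm_num
      have hC : (0 : ℝ) ≤ (if (∃ j ∈ Q, za j = c) then 1 else 0) := by split_ifs <;> norm_num
      by_cases h2 : za i = c
      · rw [if_pos h2] at hB ⊢; linarith
      · by_cases h3 : ∃ j ∈ Q, za j = c
        · rw [if_pos h3]; linarith
        · have h1 : ¬ ∃ j ∈ i :: Q, za j = c := by
            rintro ⟨j, hj, hjc⟩
            rcases List.mem_cons.1 hj with rfl | hj
            · exact h2 hjc
            · exact h3 ⟨j, hj, hjc⟩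
          rw [if_neg h1, if_neg h2, if_neg h3]; norm_num
    calc ∑ za : Fin w → Bool, prodLaw p za * (if (∃ j ∈ i :: Q, za j = c) then 1 else 0)
        ≤ ∑ za : Fin w → Bool, (prodLaw p za * (if za i = c then 1 else 0) +
            prodLaw p za * (if (∃ j ∈ Q, za j = c) then 1 else 0)) := Finset.sum_le_sum fun za _ => key za
      _ = p i c + ∑ za : Fin w → Bool, prodLaw p za * (if (∃ j ∈ Q, za j = c) then 1 else 0) := by
          rw [Finset.sum_add_distrib, sum_prodLaw_mul_indicator p hp i c]
      _ ≤ t + Q.length * t := add_le_add (ht i) (sum_prodLaw_exists_le p hp hp0 c ht Q)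
      _ = ((i :: Q).length : ℝ) * t := by simp; ring

/-- **Proposition 14 of RST for decision trees**: under a product law in which the coordinate `i`
takes the controlling value `!o` of the gate with probability `p i (!o) ≤ t`, a decision tree of
depth `≤ r` disagrees with the gate of non-controlling value `o` applied to the partially fixed
coordinates (fixed part `τa`, which every input of positive weight respects) with probability at
least `min(P[gate = o], P[gate = !o]) - r t`. (RST state it for width-`r` CNFs against
`OR_{w₀} ↾ τ`; a depth-`r` tree is such a CNF. The proof is theirs: look at the path of the
all-`∘` input.) [cite: RossmanServedioTan2015, §11.1 Prop. 14 (p. 37)] -/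
theorem disagree_ge_bias (o : Bool) (p : Fin w → Bool → ℝ) (hp : ∀ i, ∑ b : Bool, p i b = 1)
    (hp0 : ∀ i b, 0 ≤ p i b) (τa : Fin w → Option Bool)
    (hsupp : ∀ za i c, 0 < prodLaw p za → τa i = some c → za i = c)
    {t : ℝ} (ht0 : 0 ≤ t) (ht : ∀ i, p i (!o) ≤ t) {r : ℕ} (T : DTree (Unit × Fin w)) (hT : T.depth ≤ r) :
    min (∑ za : Fin w → Bool, prodLaw p za * (if gate o (fun i => (τa i).getD (za i)) = o then 1 else 0))
        (∑ za : Fin w → Bool, prodLaw p za * (if gate o (fun i => (τa i).getD (za i)) = !o then 1 else 0)) - r * t ≤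
      ∑ za : Fin w → Bool, prodLaw p za *
        (if gate o (fun i => (τa i).getD (za i)) = T.eval (fun v => za v.2) then 0 else 1) := by
  classical
  have hν : ∀ za : Fin w → Bool, 0 ≤ prodLaw p za := fun za => Finset.prod_nonneg fun j _ => hp0 _ _
  have hD0 : 0 ≤ ∑ za : Fin w → Bool, prodLaw p za *
      (if gate o (fun i => (τa i).getD (za i)) = T.eval (fun v => za v.2) then 0 else 1) :=
    Finset.sum_nonneg fun za _ => mul_nonneg (hν za) (by split_ifs <;> norm_num)
  have hrt : 0 ≤ (r : ℝ) * t := mul_nonneg (Nat.cast_nonneg r) ht0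
  set f : (Fin w → Bool) → Bool := fun za => gate o (fun i => (τa i).getD (za i)) with hf
  -- if a fixed child is controlling, the gate is constant and `P[gate = o] = 0`
  by_cases hfix : ∃ i, τa i = some (!o)
  · have hconst : ∀ za, f za = !o := by
      intro za; obtain ⟨i, hi⟩ := hfix
      simp only [hf, gate]; rw [if_pos]; exact ⟨i, by rw [hi]; rfl⟩
    have h0 : ∑ za : Fin w → Bool, prodLaw p za * (if f za = o then 1 else 0) = 0 :=
      Finset.sum_eq_zero fun za _ => by rw [hconst za, if_neg (Bool.not_ne_self o)]; ring
    calc _ ≤ (0 : ℝ) - 0 := by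
            refine sub_le_sub ?_ hrt
            exact (min_le_left _ _).trans (le_of_eq h0)
      _ ≤ _ := by simpa using hD0
  push Not at hfix
  -- the all-`∘` input and its path
  set y₀ : Unit × Fin w → Bool := fun _ => o with hy₀
  have hgate_o : ∀ za : Fin w → Bool, f za = o ↔ ∀ i, (τa i).getD (za i) ≠ !o := by
    intro za
    simp only [hf, gate]
    constructor
    · intro h i hi
      have : (∃ i, (τa i).getD (za i) = !o) := ⟨i, hi⟩
      rw [if_pos this] at h; exact Bool.not_ne_self o h
    · intro h; rw [if_neg]; push Not; exact h
  by_cases hb : T.eval y₀ = !o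
  · -- the tree is wrong on the all-`∘` event, which is `[gate = o]`
    have key : ∀ za : Fin w → Bool, prodLaw p za * (if f za = o then (1 : ℝ) else 0) ≤
        prodLaw p za * (if f za = T.eval (fun v => za v.2) then 0 else 1) := by
      intro za
      by_cases hpos : 0 < prodLaw p za
      · refine mul_le_mul_of_nonneg_left ?_ (hν za)
        by_cases hfo : f za = o
        · -- then `za` is the all-`∘` input
          have hza : (fun v : Unit × Fin w => za v.2) = y₀ := by
            funext v
            simp only [hy₀]
            have h1 := (hgate_o za).1 hfo v.2
            cases hτ : τa v.2 with
            | none => rw [hτ] at h1; simpa using h1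
            | some c =>
              have := hsupp za v.2 c hpos hτ
              rw [this]
              have hc : c ≠ !o := hfix v.2 ∘ (fun h => by rw [hτ, h])
              cases c <;> cases o <;> simp_all
          rw [if_pos hfo, if_neg]
          rw [hza, hb, hfo]; exact (Bool.not_ne_self o).symm
        · rw [if_neg hfo]; split_ifs <;> norm_num
      · have : prodLaw p za = 0 := le_antisymm (not_lt.1 hpos) (hν za)
        rw [this]; simp
    calc _ ≤ ∑ za : Fin w → Bool, prodLaw p za * (if f za = o then 1 else 0) - 0 :=
            sub_le_sub (min_le_left _ _) hrt
      _ ≤ _ := by rw [sub_zero]; exact Finset.sum_le_sum fun za _ => key za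
  · -- the tree says `o` along the all-`∘` path: wrong whenever the gate fires off the path
    have hb' : T.eval y₀ = o := by cases h : T.eval y₀ <;> cases o <;> simp_all
    set Q : List (Fin w) := (T.qpath y₀).map Prod.snd with hQ
    have hQlen : (Q.length : ℝ) ≤ r := by
      rw [hQ, List.length_map]; exact_mod_cast (DTree.length_qpath_le y₀ T).trans hT
    have key : ∀ za : Fin w → Bool,
        prodLaw p za * (if f za = !o then (1 : ℝ) else 0) - prodLaw p za * (if (∃ i ∈ Q, za i = !o) then 1 else 0) ≤
        prodLaw p za * (if f za = T.eval (fun v => za v.2) then 0 else 1) := by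
      intro za
      rw [← mul_sub]
      refine mul_le_mul_of_nonneg_left ?_ (hν za)
      by_cases hfo : f za = !o
      · by_cases hQ' : ∃ i ∈ Q, za i = !o
        · rw [if_pos hfo, if_pos hQ']; split_ifs <;> norm_num
        · -- agrees with the all-`∘` input on the path
          have hag : ∀ v ∈ T.qpath y₀, (fun v : Unit × Fin w => za v.2) v = y₀ v := by
            intro v hv
            simp only [hy₀]
            have : za v.2 ≠ !o := fun h => hQ' ⟨v.2, List.mem_map.2 ⟨v, hv, rfl⟩, h⟩
            cases hz : za v.2 <;> cases o <;> simp_all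
          have hev := DTree.eval_eq_of_agree T hag
          rw [if_pos hfo, if_neg hQ', if_neg]
          · norm_num
          · rw [hev, hb', hfo]; exact Bool.not_ne_self o
      · rw [if_neg hfo]; split_ifs <;> norm_num
    have hmarg : ∀ i, p i (!o) ≤ t := ht
    calc _ ≤ ∑ za : Fin w → Bool, prodLaw p za * (if f za = !o then 1 else 0) - Q.length * t := by
            refine sub_le_sub (min_le_right _ _) ?_
            exact mul_le_mul_of_nonneg_right hQlen ht0
      _ ≤ ∑ za : Fin w → Bool, prodLaw p za * (if f za = !o then 1 else 0) -
            ∑ za : Fin w → Bool, prodLaw p za * (if (∃ i ∈ Q, za i = !o) then 1 else 0) :=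
          sub_le_sub_left (sum_prodLaw_exists_le p hp hp0 (!o) hmarg Q) _
      _ = ∑ za : Fin w → Bool, (prodLaw p za * (if f za = !o then 1 else 0) -
            prodLaw p za * (if (∃ i ∈ Q, za i = !o) then 1 else 0)) := by rw [Finset.sum_sub_distrib]
      _ ≤ _ := Finset.sum_le_sum fun za _ => key za

end Prop14


end RSTProj

end Literature.Computability.Complexity

end
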